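import Summits.QuantumFields.YangMills.Theorems.UnitScaleTiltProp7CovInterpKernelDual
import Summits.QuantumFields.YangMills.Theorems.UnitScaleTiltProp7CovAgmonLetters
import HarnessLib

/-!
# Route `UnitScaleTilt`, crux K1 «MinimiserStabilityRegPr» (stmt-QuantumFields-19200), route-R E′ path (α′), (E1-b) at the CURVED background, P-cov2 row (EL-loc-cov):
# THE LOCALISED EULER–LAGRANGE SOURCES OF THE PEELED COVARIANT REMAINDER — the covariant twin of ✓ `Prop7PinnedPeelingEL` in routeR-w6 g6's `hs`∕re-trace letters:
# for `e := (1−χ)•V − φ_H` (`χ` a real cutoff with `(1−χ)•Δ_U²V = 0`, `φ_H` `Δ_U`-biharmonic off the pins) and every pinned test field `v`,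
# `Σ_x⟨Δ_Ue, Δ_Uv⟩ = Σ_x⟨h, Δ_Uv⟩ + Σ_xΣ_μ⟨ht_μ, D_μv⟩ + Σ_x⟨s, v⟩` with `h = χ•g − Δ_U(χ•V)`, `ht_μ(x) = −∂χ(x,μ)•g(x)`, `s(x) = Σ_μ ∂χ(x,μ)•D_μg(x)`, `g := Δ_UV`
# — EXACTLY the `hEL` binder of routeR-w6 g6's covariant Agmon estimate `weighted_covLaplace_le_core`; the one transport `R(U_b)` of the unpaired commutator CANCELS in the pairing

Cell `ym3-torus`, width seat `ym3-torus-px22` (gen 2), on ★routeR-w3 g6's word «px22 g2: (A-door-cov) LOCATE → brick» (21:47:43Z); LOCATE 19200 evidence `LOCATE-ADOORCOV-px22g2.md`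
(b4fc5e92eeacdffd) §2–§3.  `--supports stmt-QuantumFields-19200`, count-neutral.  THEOREMS ONLY (0 `def`, 0 `sorry`).  YM₃ on T³ is a ladder rung (R3), not the Clay problem;
nothing here claims the stub, the crux, d = 4 or the gap.

LETTERS (routeR-w6 g6, ✓ `Prop7CovInterpKernelDual` ∕ ✓ `Prop7CovAgmonLetters`): torus `Site P i`, `T = torusT P i`, `U : Fin d → Site P i → (M_N ℂ)ˣ` unitary (`hU`),
`covD T U μ f x = R(U_μ x) f(x+e_μ) − f x`, `Δ_Uf x = divB T U (fun μ => covD T U μ f) x`, pairing `⟨X,Y⟩ = ((Xᴴ * Y).trace).re`, real scalars act by `•`, `∂χ(x,μ) = χ(x+e_μ) − χ(x)`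
spelled out; lattice factor `c = 1` (as in P-cov1 ✓p655977).

WHAT IS PROVED (ns `…Theorems.Prop7CovPinnedPeelingEL`).
* §1 pairing bookkeeping: `reTr_smul_left`, `reTr_sub_left`, `reTr_add_left∕_right`, `reTr_neg_left`, `reTr_sum_left`, `reTr_R_R` (`⟨R u X, R u Y⟩ = ⟨X, Y⟩`, unitary `u`),
  ★ `reTr_shift` — the covariant Leibniz rule of the GAUGE-INVARIANT scalar `p = ⟨g, v⟩`: `p(x+e_μ) = ⟨g x + D_μg x, v x + D_μv x⟩`.
* §2 ★★ `sum_re_trace_comm_covLaplace_smul` — THE PAIRED COMMUTATOR HAS NO JUNK: `Σ_x⟨Δ_U(χ•g) − χ•Δ_Ug, v⟩ = Σ_xΣ_μ ∂χ·⟨g, D_μv⟩ − Σ_xΣ_μ ∂χ·⟨D_μg, v⟩`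
  (the unpaired commutator is ✓ `Prop7ConjFrameTransport.divB_covD_smul_fun`; its backward term `D*_μg(x+e_μ) = R(U_μx)⁻¹g x − g(x+e_μ)` is moved by unitarity
  ✓ `re_trace_conjTranspose_mul_R` onto `R(U_μx)v(x+e_μ) = v x + D_μv x`, and the transported piece is eaten by the flat second difference of `χ` against `p`).
* §3 `sum_re_trace_covLaplace_sub_biharmonic` (= flat ✓ `el_of_biharmonic_off`), `covLaplace_one_sub_smul`, `covLaplace_one_sub_smul_of_vanish`,
  ★★★ `el_of_peeled_cov` (the `hEL` row, verbatim shape).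
* §4 support letters `h_cov_eq_zero_of_locally_const`, `ht_cov_eq_zero_of_eq`, `s_cov_eq_zero_of_locally_const` (the sources live where `χ` varies).
HONEST SCOPE.  Exact algebra at a unitary background; no estimate.  The assembly (A-door-cov) over routeR-w6 g6's `weighted_covLaplace_le_core` is the next file.

References: T. Bałaban, CMP 99 (1985) 389–434 [Balaban1985BackgroundPropagators] ((3.3) p.390, (3.8) p.392); CMP 96 (1984) 223–250 [Balaban1984PropagatorsII] ((1.9) p.226);
CMP 99 (1985) 75–102 [Balaban1985RegularSpaces] ((1.14) p.78).
-/

set_option autoImplicit false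

noncomputable section

open scoped BigOperators Matrix

namespace Summit.QuantumFields.YangMills.Theorems.Prop7CovPinnedPeelingEL

open Literature.MathematicalPhysics.QuantumFieldTheory.Balaban1983to89
open B9Eq39Adjoint (R R_def covD covDstar divB)
open B9TorusCalculus (torusT torusT_apply torusT_symm_apply)
open B10StarCount (shift_unshift unshift_shift)
open Summit.QuantumFields.YangMills.Theorems.Prop7FlatCoercivity (sum_shift)
open Summit.QuantumFields.YangMills.Theorems.Prop7CovInterpKernelDual (re_trace_conjTranspose_mul_R covLaplace_sub sum_re_trace_covLaplace_comm)
open Summit.QuantumFields.YangMills.Theorems.Prop7ConjFrameTransport (divB_covD_smul_fun)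

variable {P : Params} {i : ℕ} {N : ℕ}

/-! ## §1 Pairing bookkeeping -/

/-- `⟨r•X, Y⟩ = r·⟨X, Y⟩` (real scalar). [folklore] -/
theorem reTr_smul_left (r : ℝ) (X Y : Matrix (Fin N) (Fin N) ℂ) :
    (((r • X)ᴴ * Y).trace).re = r * ((Xᴴ * Y).trace).re := by
  rw [Matrix.conjTranspose_smul, star_trivial, Matrix.smul_mul, Matrix.trace_smul, Complex.real_smul, Complex.re_ofReal_mul]

/-- `⟨X − X′, Y⟩ = ⟨X, Y⟩ − ⟨X′, Y⟩`. [folklore] -/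
theorem reTr_sub_left (X X' Y : Matrix (Fin N) (Fin N) ℂ) :
    (((X - X')ᴴ * Y).trace).re = ((Xᴴ * Y).trace).re - ((X'ᴴ * Y).trace).re := by
  rw [Matrix.conjTranspose_sub, Matrix.sub_mul, Matrix.trace_sub, Complex.sub_re]

/-- `⟨X + X′, Y⟩ = ⟨X, Y⟩ + ⟨X′, Y⟩`. [folklore] -/
theorem reTr_add_left (X X' Y : Matrix (Fin N) (Fin N) ℂ) :
    (((X + X')ᴴ * Y).trace).re = ((Xᴴ * Y).trace).re + ((X'ᴴ * Y).trace).re := by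
  rw [Matrix.conjTranspose_add, Matrix.add_mul, Matrix.trace_add, Complex.add_re]

/-- `⟨X, Y + Y′⟩ = ⟨X, Y⟩ + ⟨X, Y′⟩`. [folklore] -/
theorem reTr_add_right (X Y Y' : Matrix (Fin N) (Fin N) ℂ) :
    ((Xᴴ * (Y + Y')).trace).re = ((Xᴴ * Y).trace).re + ((Xᴴ * Y').trace).re := by
  rw [Matrix.mul_add, Matrix.trace_add, Complex.add_re]

/-- `⟨−X, Y⟩ = −⟨X, Y⟩`. [folklore] -/
theorem reTr_neg_left (X Y : Matrix (Fin N) (Fin N) ℂ) :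
    (((-X)ᴴ * Y).trace).re = -((Xᴴ * Y).trace).re := by
  rw [Matrix.conjTranspose_neg, Matrix.neg_mul, Matrix.trace_neg, Complex.neg_re]

/-- `⟨Σ_μ X_μ, Y⟩ = Σ_μ ⟨X_μ, Y⟩`. [folklore] -/
theorem reTr_sum_left {ι : Type*} (s : Finset ι) (X : ι → Matrix (Fin N) (Fin N) ℂ) (Y : Matrix (Fin N) (Fin N) ℂ) :
    (((∑ μ ∈ s, X μ)ᴴ * Y).trace).re = ∑ μ ∈ s, (((X μ)ᴴ * Y).trace).re := by
  rw [Matrix.conjTranspose_sum, Finset.sum_mul, Matrix.trace_sum, Complex.re_sum]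

/-- **UNITARITY OF THE PAIRING**: `⟨R(u)X, R(u)Y⟩ = ⟨X, Y⟩`. [cite: Balaban1985BackgroundPropagators, (3.3) p.390] -/
theorem reTr_R_R {u : (Matrix (Fin N) (Fin N) ℂ)ˣ} (hu : (u : Matrix (Fin N) (Fin N) ℂ) ∈ unitary (Matrix (Fin N) (Fin N) ℂ))
    (X Y : Matrix (Fin N) (Fin N) ℂ) :
    (((R u X)ᴴ * R u Y).trace).re = ((Xᴴ * Y).trace).re := by
  rw [re_trace_conjTranspose_mul_R hu, B9Eq39Adjoint.R_inv_R]

variable {U : Fin P.d → Site P i → (Matrix (Fin N) (Fin N) ℂ)ˣ}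

/-- ★ **COVARIANT LEIBNIZ FOR THE GAUGE-INVARIANT SCALAR `p = ⟨g, v⟩`**: `p(x + e_μ) = ⟨g x + D_μg x, v x + D_μv x⟩` (both arguments are `R(U_μ x)` of the shifted values;
the pairing is unitarily invariant). [cite: Balaban1985BackgroundPropagators, (3.3) p.390] -/
theorem reTr_shift (hU : ∀ ν x, (U ν x : Matrix (Fin N) (Fin N) ℂ) ∈ unitary (Matrix (Fin N) (Fin N) ℂ))
    (μ : Fin P.d) (g v : Site P i → Matrix (Fin N) (Fin N) ℂ) (x : Site P i) :
    (((g (x.shift μ))ᴴ * v (x.shift μ)).trace).re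
      = (((g x + covD (torusT P i) U μ g x)ᴴ * (v x + covD (torusT P i) U μ v x)).trace).re := by
  have e1 : g x + covD (torusT P i) U μ g x = R (U μ x) (g (x.shift μ)) := by
    simp only [covD, torusT_apply]; abel
  have e2 : v x + covD (torusT P i) U μ v x = R (U μ x) (v (x.shift μ)) := by
    simp only [covD, torusT_apply]; abel
  rw [e1, e2, reTr_R_R (hU μ x)]

/-! ## §2 ★★ The paired commutator `Σ⟨[Δ_U, χ]g, v⟩` -/

/-- the backward derivative at `x + e_μ`: `D*_μg(x+e_μ) = R(U_μ x)⁻¹ g x − g(x+e_μ)`. [cite: Balaban1985BackgroundPropagators, (3.8) p.392] -/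
theorem covDstar_shift (μ : Fin P.d) (g : Site P i → Matrix (Fin N) (Fin N) ℂ) (x : Site P i) :
    covDstar (torusT P i) U μ g (x.shift μ) = R (U μ x)⁻¹ (g x) - g (x.shift μ) := by
  simp only [covDstar, torusT_symm_apply, unshift_shift]

/-- the paired backward derivative: `⟨D*_μg(x+e_μ), v(x+e_μ)⟩ = ⟨g x, D_μv x⟩ − (p(x+e_μ) − p(x))`, `p = ⟨g, v⟩`. [cite: Balaban1985BackgroundPropagators, (3.8) p.392] -/
theorem reTr_covDstar_shift (hU : ∀ ν x, (U ν x : Matrix (Fin N) (Fin N) ℂ) ∈ unitary (Matrix (Fin N) (Fin N) ℂ))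
    (μ : Fin P.d) (g v : Site P i → Matrix (Fin N) (Fin N) ℂ) (x : Site P i) :
    (((covDstar (torusT P i) U μ g (x.shift μ))ᴴ * v (x.shift μ)).trace).re
      = (((g x)ᴴ * covD (torusT P i) U μ v x).trace).re
        - ((((g (x.shift μ))ᴴ * v (x.shift μ)).trace).re - (((g x)ᴴ * v x).trace).re) := by
  have e2 : R (U μ x) (v (x.shift μ)) = v x + covD (torusT P i) U μ v x := by
    simp only [covD, torusT_apply]; abel
  rw [covDstar_shift, reTr_sub_left, ← re_trace_conjTranspose_mul_R (hU μ x), e2, reTr_add_right]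
  ring

/-- ★★ **THE PAIRED COMMUTATOR HAS NO JUNK**: for a real `χ`, matrix fields `g v`, unitary `U`:
`Σ_x ⟨Δ_U(χ•g)(x) − χ(x)•Δ_Ug(x), v(x)⟩ = Σ_xΣ_μ ∂χ(x,μ)·⟨g x, D_μv x⟩ − Σ_xΣ_μ ∂χ(x,μ)·⟨D_μg x, v x⟩` — the flat ✓ `Prop7PinnedPeelingEL.sum_comm_laplace_mul` verbatim.
[cite: Balaban1985BackgroundPropagators, (3.8) p.392; Balaban1984PropagatorsII, (1.9) p.226] -/
theorem sum_re_trace_comm_covLaplace_smul (hU : ∀ ν x, (U ν x : Matrix (Fin N) (Fin N) ℂ) ∈ unitary (Matrix (Fin N) (Fin N) ℂ))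
    (χ : Site P i → ℝ) (g v : Site P i → Matrix (Fin N) (Fin N) ℂ) :
    ∑ x, (((divB (torusT P i) U (fun μ => covD (torusT P i) U μ (fun z => χ z • g z)) x
            - χ x • divB (torusT P i) U (fun μ => covD (torusT P i) U μ g) x)ᴴ * v x).trace).re
      = ∑ x, ∑ μ, (χ (x.shift μ) - χ x) * (((g x)ᴴ * covD (torusT P i) U μ v x).trace).re
        - ∑ x, ∑ μ, (χ (x.shift μ) - χ x) * (((covD (torusT P i) U μ g x)ᴴ * v x).trace).re := by
  -- the unpaired commutator (✓ `divB_covD_smul_fun`)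
  have hexp : ∀ x, divB (torusT P i) U (fun μ => covD (torusT P i) U μ (fun z => χ z • g z)) x
        - χ x • divB (torusT P i) U (fun μ => covD (torusT P i) U μ g) x
      = ∑ μ, ((χ x - χ (x.unshift μ)) • covDstar (torusT P i) U μ g x - (χ (x.shift μ) - χ x) • covD (torusT P i) U μ g x
          - ((χ (x.shift μ) - χ x) - (χ x - χ (x.unshift μ))) • g x) := by
    intro x
    rw [divB_covD_smul_fun (torusT P i) U χ g x]
    simp only [torusT_apply, torusT_symm_apply]
    abel
  -- pair and split into three sums
  have hpair : ∀ x, (((divB (torusT P i) U (fun μ => covD (torusT P i) U μ (fun z => χ z • g z)) x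
        - χ x • divB (torusT P i) U (fun μ => covD (torusT P i) U μ g) x)ᴴ * v x).trace).re
      = ∑ μ, ((χ x - χ (x.unshift μ)) * (((covDstar (torusT P i) U μ g x)ᴴ * v x).trace).re
          - (χ (x.shift μ) - χ x) * (((covD (torusT P i) U μ g x)ᴴ * v x).trace).re
          - ((χ (x.shift μ) - χ x) - (χ x - χ (x.unshift μ))) * (((g x)ᴴ * v x).trace).re) := by
    intro x
    rw [hexp x, reTr_sum_left]
    refine Finset.sum_congr rfl fun μ _ => ?_
    rw [reTr_sub_left, reTr_sub_left, reTr_smul_left, reTr_smul_left, reTr_smul_left]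
  rw [Finset.sum_congr rfl fun x _ => hpair x]
  -- (T1) the backward term, reindexed by `x = y + e_μ`
  have hT1 : ∀ μ : Fin P.d, ∑ x, (χ x - χ (x.unshift μ)) * (((covDstar (torusT P i) U μ g x)ᴴ * v x).trace).re
      = ∑ x, (χ (x.shift μ) - χ x) * ((((g x)ᴴ * covD (torusT P i) U μ v x).trace).re
          - ((((g (x.shift μ))ᴴ * v (x.shift μ)).trace).re - (((g x)ᴴ * v x).trace).re)) := by
    intro μ
    rw [← sum_shift μ (fun x => (χ x - χ (x.unshift μ)) * (((covDstar (torusT P i) U μ g x)ᴴ * v x).trace).re)]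
    refine Finset.sum_congr rfl fun x _ => ?_
    simp only [unshift_shift]
    rw [reTr_covDstar_shift hU]
  -- (T3) the flat second difference of `χ` against `p`, reindexed
  have hT3 : ∀ μ : Fin P.d, ∑ x, (χ x - χ (x.unshift μ)) * (((g x)ᴴ * v x).trace).re
      = ∑ x, (χ (x.shift μ) - χ x) * (((g (x.shift μ))ᴴ * v (x.shift μ)).trace).re := by
    intro μ
    rw [← sum_shift μ (fun x => (χ x - χ (x.unshift μ)) * (((g x)ᴴ * v x).trace).re)]
    refine Finset.sum_congr rfl fun x _ => ?_
    simp only [unshift_shift]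
  -- bookkeeping: swap `Σ_x Σ_μ`, apply (T1), (T3) per direction, swap back
  have hL : ∑ x, ∑ μ, ((χ x - χ (x.unshift μ)) * (((covDstar (torusT P i) U μ g x)ᴴ * v x).trace).re
          - (χ (x.shift μ) - χ x) * (((covD (torusT P i) U μ g x)ᴴ * v x).trace).re
          - ((χ (x.shift μ) - χ x) - (χ x - χ (x.unshift μ))) * (((g x)ᴴ * v x).trace).re)
      = ∑ μ, (∑ x, (χ x - χ (x.unshift μ)) * (((covDstar (torusT P i) U μ g x)ᴴ * v x).trace).re
          - ∑ x, (χ (x.shift μ) - χ x) * (((covD (torusT P i) U μ g x)ᴴ * v x).trace).re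
          - (∑ x, (χ (x.shift μ) - χ x) * (((g x)ᴴ * v x).trace).re - ∑ x, (χ x - χ (x.unshift μ)) * (((g x)ᴴ * v x).trace).re)) := by
    rw [Finset.sum_comm]
    refine Finset.sum_congr rfl fun μ _ => ?_
    rw [← Finset.sum_sub_distrib, ← Finset.sum_sub_distrib, ← Finset.sum_sub_distrib]
    refine Finset.sum_congr rfl fun x _ => ?_
    ring
  rw [hL]
  have hR1 : ∑ x, ∑ μ, (χ (x.shift μ) - χ x) * (((g x)ᴴ * covD (torusT P i) U μ v x).trace).re
      = ∑ μ, ∑ x, (χ (x.shift μ) - χ x) * (((g x)ᴴ * covD (torusT P i) U μ v x).trace).re := Finset.sum_comm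
  have hR2 : ∑ x, ∑ μ, (χ (x.shift μ) - χ x) * (((covD (torusT P i) U μ g x)ᴴ * v x).trace).re
      = ∑ μ, ∑ x, (χ (x.shift μ) - χ x) * (((covD (torusT P i) U μ g x)ᴴ * v x).trace).re := Finset.sum_comm
  rw [hR1, hR2, ← Finset.sum_sub_distrib]
  refine Finset.sum_congr rfl fun μ _ => ?_
  rw [hT1 μ, hT3 μ]
  have e4 : ∑ x, (χ (x.shift μ) - χ x) * ((((g x)ᴴ * covD (torusT P i) U μ v x).trace).re
          - ((((g (x.shift μ))ᴴ * v (x.shift μ)).trace).re - (((g x)ᴴ * v x).trace).re))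
      = ∑ x, (χ (x.shift μ) - χ x) * (((g x)ᴴ * covD (torusT P i) U μ v x).trace).re
        - (∑ x, (χ (x.shift μ) - χ x) * (((g (x.shift μ))ᴴ * v (x.shift μ)).trace).re
            - ∑ x, (χ (x.shift μ) - χ x) * (((g x)ᴴ * v x).trace).re) := by
    rw [← Finset.sum_sub_distrib, ← Finset.sum_sub_distrib]
    refine Finset.sum_congr rfl fun x _ => ?_
    ring
  rw [e4]
  ring

/-! ## §3 The Euler–Lagrange identity of the peeled covariant remainder -/

/-- **`φ_H` DROPS OUT** (= flat ✓ `el_of_biharmonic_off`): for `φ_H` with `Δ_U²φ_H = 0` off `C` and `v` pinned on `C`,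
`Σ_x⟨Δ_U(F − φ_H), Δ_Uv⟩ = Σ_x⟨Δ_UF, Δ_Uv⟩`. [cite: Balaban1985BackgroundPropagators, (3.8) p.392; Balaban1985RegularSpaces, (1.14) p.78] -/
theorem sum_re_trace_covLaplace_sub_biharmonic (hU : ∀ ν x, (U ν x : Matrix (Fin N) (Fin N) ℂ) ∈ unitary (Matrix (Fin N) (Fin N) ℂ))
    (C : Set (Site P i)) (F φH : Site P i → Matrix (Fin N) (Fin N) ℂ)
    (hEL : ∀ x ∉ C, divB (torusT P i) U (fun μ => covD (torusT P i) U μ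
      (fun y => divB (torusT P i) U (fun ν => covD (torusT P i) U ν φH) y)) x = 0)
    (v : Site P i → Matrix (Fin N) (Fin N) ℂ) (hv : ∀ y ∈ C, v y = 0) :
    ∑ x, (((divB (torusT P i) U (fun μ => covD (torusT P i) U μ (fun y => F y - φH y)) x)ᴴ
          * divB (torusT P i) U (fun μ => covD (torusT P i) U μ v) x).trace).re
      = ∑ x, (((divB (torusT P i) U (fun μ => covD (torusT P i) U μ F) x)ᴴ
          * divB (torusT P i) U (fun μ => covD (torusT P i) U μ v) x).trace).re := by
  classical
  have h0 : ∑ x, (((divB (torusT P i) U (fun μ => covD (torusT P i) U μ φH) x)ᴴ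
      * divB (torusT P i) U (fun μ => covD (torusT P i) U μ v) x).trace).re = 0 := by
    rw [← sum_re_trace_covLaplace_comm hU]
    refine Finset.sum_eq_zero fun x _ => ?_
    by_cases hx : x ∈ C
    · rw [hv x hx, Matrix.mul_zero, Matrix.trace_zero, Complex.zero_re]
    · rw [hEL x hx, Matrix.conjTranspose_zero, Matrix.zero_mul, Matrix.trace_zero, Complex.zero_re]
  rw [← sub_zero (∑ x, (((divB (torusT P i) U (fun μ => covD (torusT P i) U μ F) x)ᴴ
      * divB (torusT P i) U (fun μ => covD (torusT P i) U μ v) x).trace).re), ← h0, ← Finset.sum_sub_distrib]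
  refine Finset.sum_congr rfl fun x _ => ?_
  rw [covLaplace_sub, reTr_sub_left]

/-- `Δ_U((1−χ)•F) = Δ_UF − Δ_U(χ•F)` pointwise. [cite: Balaban1985BackgroundPropagators, (3.8) p.392] -/
theorem covLaplace_one_sub_smul (χ : Site P i → ℝ) (F : Site P i → Matrix (Fin N) (Fin N) ℂ) (x : Site P i) :
    divB (torusT P i) U (fun μ => covD (torusT P i) U μ (fun y => (1 - χ y) • F y)) x
      = divB (torusT P i) U (fun μ => covD (torusT P i) U μ F) x
        - divB (torusT P i) U (fun μ => covD (torusT P i) U μ (fun y => χ y • F y)) x := by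
  have e : (fun y => (1 - χ y) • F y) = fun y => F y - χ y • F y := by
    funext y; rw [sub_smul, one_smul]
  rw [e, covLaplace_sub]

/-- `Δ_U((1−χ)•g) = χ•Δ_Ug − Δ_U(χ•g)` when `(1−χ)•Δ_Ug = 0` (the cutoff covers the support of `Δ_Ug`). [cite: Balaban1984PropagatorsII, (1.9) p.226] -/
theorem covLaplace_one_sub_smul_of_vanish (χ : Site P i → ℝ) (g f : Site P i → Matrix (Fin N) (Fin N) ℂ)
    (hf : ∀ x, divB (torusT P i) U (fun μ => covD (torusT P i) U μ g) x = f x) (hχf : ∀ x, (1 - χ x) • f x = 0) (x : Site P i) :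
    divB (torusT P i) U (fun μ => covD (torusT P i) U μ (fun y => (1 - χ y) • g y)) x
      = χ x • divB (torusT P i) U (fun μ => covD (torusT P i) U μ g) x
        - divB (torusT P i) U (fun μ => covD (torusT P i) U μ (fun y => χ y • g y)) x := by
  rw [covLaplace_one_sub_smul, hf x]
  have h1 : f x = χ x • f x := by
    have := hχf x
    rw [sub_smul, one_smul, sub_eq_zero] at this
    exact this
  rw [← h1]

/-- ★★★ **THE EULER–LAGRANGE IDENTITY OF THE PEELED COVARIANT REMAINDER** — EXACTLY the `hEL` binder of routeR-w6 g6's `weighted_covLaplace_le_core` for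
`e := (1−χ)•V − φ_H`.  DATA: `Δ_UV = g`, `Δ_Ug = f`, a real cutoff `χ` with `(1−χ)•f = 0`, `φ_H` `Δ_U`-biharmonic off `C`.  Then for every `v` pinned on `C`:
`Σ_x⟨Δ_Ue x, Δ_Uv x⟩ = Σ_x⟨χ x•g x − Δ_U(χ•V) x, Δ_Uv x⟩ + Σ_xΣ_μ⟨−(∂χ(x,μ)•g x), D_μv x⟩ + Σ_x⟨Σ_μ ∂χ(x,μ)•D_μg x, v x⟩` — three LOCALISED sources
(type 1, type 1½, type 3), all supported where `χ` varies (§4). [cite: Balaban1984PropagatorsII, (1.9) p.226; Balaban1985BackgroundPropagators, (3.8) p.392; Balaban1985RegularSpaces, (1.14) p.78] -/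
theorem el_of_peeled_cov (hU : ∀ ν x, (U ν x : Matrix (Fin N) (Fin N) ℂ) ∈ unitary (Matrix (Fin N) (Fin N) ℂ))
    (C : Set (Site P i)) (χ : Site P i → ℝ) (V g f φH : Site P i → Matrix (Fin N) (Fin N) ℂ)
    (hg : ∀ x, divB (torusT P i) U (fun μ => covD (torusT P i) U μ V) x = g x)
    (hf : ∀ x, divB (torusT P i) U (fun μ => covD (torusT P i) U μ g) x = f x)
    (hχf : ∀ x, (1 - χ x) • f x = 0)
    (hEL : ∀ x ∉ C, divB (torusT P i) U (fun μ => covD (torusT P i) U μ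
      (fun y => divB (torusT P i) U (fun ν => covD (torusT P i) U ν φH) y)) x = 0)
    (v : Site P i → Matrix (Fin N) (Fin N) ℂ) (hv : ∀ y ∈ C, v y = 0) :
    ∑ x, (((divB (torusT P i) U (fun μ => covD (torusT P i) U μ (fun y => (1 - χ y) • V y - φH y)) x)ᴴ
          * divB (torusT P i) U (fun μ => covD (torusT P i) U μ v) x).trace).re
      = ∑ x, (((χ x • g x - divB (torusT P i) U (fun μ => covD (torusT P i) U μ (fun y => χ y • V y)) x)ᴴ
            * divB (torusT P i) U (fun μ => covD (torusT P i) U μ v) x).trace).re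
        + ∑ x, ∑ μ, (((-((χ (x.shift μ) - χ x) • g x))ᴴ * covD (torusT P i) U μ v x).trace).re
        + ∑ x, (((∑ μ, (χ (x.shift μ) - χ x) • covD (torusT P i) U μ g x)ᴴ * v x).trace).re := by
  -- `φ_H` drops out
  rw [sum_re_trace_covLaplace_sub_biharmonic hU C (fun y => (1 - χ y) • V y) φH hEL v hv]
  -- `Δ_U((1−χ)•V) = (χ•g − Δ_U(χ•V)) + (1−χ)•g`
  have e1 : ∀ x, divB (torusT P i) U (fun μ => covD (torusT P i) U μ (fun y => (1 - χ y) • V y)) x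
      = (χ x • g x - divB (torusT P i) U (fun μ => covD (torusT P i) U μ (fun y => χ y • V y)) x) + (1 - χ x) • g x := by
    intro x
    rw [covLaplace_one_sub_smul, hg x, sub_smul, one_smul]
    abel
  have e2 : ∑ x, (((divB (torusT P i) U (fun μ => covD (torusT P i) U μ (fun y => (1 - χ y) • V y)) x)ᴴ
          * divB (torusT P i) U (fun μ => covD (torusT P i) U μ v) x).trace).re
      = ∑ x, (((χ x • g x - divB (torusT P i) U (fun μ => covD (torusT P i) U μ (fun y => χ y • V y)) x)ᴴ
            * divB (torusT P i) U (fun μ => covD (torusT P i) U μ v) x).trace).re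
        + ∑ x, ((((1 - χ x) • g x)ᴴ * divB (torusT P i) U (fun μ => covD (torusT P i) U μ v) x).trace).re := by
    rw [← Finset.sum_add_distrib]
    exact Finset.sum_congr rfl fun x _ => by rw [e1 x, reTr_add_left]
  rw [e2, add_assoc]
  congr 1
  -- `Σ⟨(1−χ)•g, Δ_Uv⟩ = Σ⟨Δ_U((1−χ)•g), v⟩ = −Σ⟨[Δ_U,χ]g, v⟩`
  have e3 : ∑ x, ((((1 - χ x) • g x)ᴴ * divB (torusT P i) U (fun μ => covD (torusT P i) U μ v) x).trace).re
      = -∑ x, (((divB (torusT P i) U (fun μ => covD (torusT P i) U μ (fun z => χ z • g z)) x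
            - χ x • divB (torusT P i) U (fun μ => covD (torusT P i) U μ g) x)ᴴ * v x).trace).re := by
    rw [← sum_re_trace_covLaplace_comm hU (fun x => (1 - χ x) • g x) v, ← Finset.sum_neg_distrib]
    refine Finset.sum_congr rfl fun x _ => ?_
    rw [covLaplace_one_sub_smul_of_vanish χ g f hf hχf x, ← reTr_neg_left, neg_sub]
  rw [e3, sum_re_trace_comm_covLaplace_smul hU χ g v]
  -- match the two source pairings
  have e4 : ∑ x, ∑ μ, (((-((χ (x.shift μ) - χ x) • g x))ᴴ * covD (torusT P i) U μ v x).trace).re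
      = -∑ x, ∑ μ, (χ (x.shift μ) - χ x) * (((g x)ᴴ * covD (torusT P i) U μ v x).trace).re := by
    rw [← Finset.sum_neg_distrib]
    refine Finset.sum_congr rfl fun x _ => ?_
    rw [← Finset.sum_neg_distrib]
    refine Finset.sum_congr rfl fun μ _ => ?_
    rw [reTr_neg_left, reTr_smul_left]
  have e5 : ∑ x, (((∑ μ, (χ (x.shift μ) - χ x) • covD (torusT P i) U μ g x)ᴴ * v x).trace).re
      = ∑ x, ∑ μ, (χ (x.shift μ) - χ x) * (((covD (torusT P i) U μ g x)ᴴ * v x).trace).re := by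
    refine Finset.sum_congr rfl fun x _ => ?_
    rw [reTr_sum_left]
    exact Finset.sum_congr rfl fun μ _ => reTr_smul_left _ _ _
  rw [e4, e5]
  ring

/-! ## §4 Where the sources live -/

/-- **THE TYPE-1 SOURCE VANISHES WHERE `χ` IS LOCALLY CONSTANT**: if `χ(x ± e_μ) = χ(x)` for all `μ` then `χ x•g x − Δ_U(χ•V) x = 0` (`g = Δ_UV`). [cite: Balaban1984PropagatorsII, (1.9) p.226] -/
theorem h_cov_eq_zero_of_locally_const (χ : Site P i → ℝ) (V g : Site P i → Matrix (Fin N) (Fin N) ℂ)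
    (hg : ∀ x, divB (torusT P i) U (fun μ => covD (torusT P i) U μ V) x = g x) (x : Site P i)
    (hfw : ∀ μ, χ (x.shift μ) = χ x) (hbw : ∀ μ, χ (x.unshift μ) = χ x) :
    χ x • g x - divB (torusT P i) U (fun μ => covD (torusT P i) U μ (fun y => χ y • V y)) x = 0 := by
  rw [divB_covD_smul_fun (torusT P i) U χ V x, hg x]
  simp only [torusT_apply, torusT_symm_apply, hfw, hbw, sub_self, zero_smul, Finset.sum_const_zero, add_zero]

/-- **THE TYPE-1½ SOURCE VANISHES ON BONDS WHERE `χ` DOES NOT CHANGE**. [cite: Balaban1984PropagatorsII, (1.9) p.226] -/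
theorem ht_cov_eq_zero_of_eq (χ : Site P i → ℝ) (g : Site P i → Matrix (Fin N) (Fin N) ℂ) (μ : Fin P.d) (x : Site P i)
    (h : χ (x.shift μ) = χ x) : -((χ (x.shift μ) - χ x) • g x) = 0 := by
  rw [h, sub_self, zero_smul, neg_zero]

/-- **THE TYPE-3 SOURCE VANISHES WHERE `χ` IS FORWARD-CONSTANT**. [cite: Balaban1984PropagatorsII, (1.9) p.226] -/
theorem s_cov_eq_zero_of_locally_const (χ : Site P i → ℝ) (g : Site P i → Matrix (Fin N) (Fin N) ℂ) (x : Site P i)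
    (hfw : ∀ μ, χ (x.shift μ) = χ x) :
    ∑ μ, (χ (x.shift μ) - χ x) • covD (torusT P i) U μ g x = 0 :=
  Finset.sum_eq_zero fun μ _ => by rw [hfw μ, sub_self, zero_smul]

end Summit.QuantumFields.YangMills.Theorems.Prop7CovPinnedPeelingEL

end
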